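import Mathlib
import Summits.ValiantsHypothesis.ValiantsHypothesis.Theorems.NewtonUnitEquationsDissociatedUniformTotalsLawTwoTopsCount
import Summits.ValiantsHypothesis.ValiantsHypothesis.Theorems.NewtonUnitEquationsDissociatedUniformTotalsLawSharpFibreTotals
import HarnessLib

/-!
# Crux `NewtonUnitEquations.DissociatedUniform` (stmt-ValiantsHypothesis-5905): the DOMINANT-REGIME TOTALS LAW for GENERAL pairs —
# `T ≤ 3q²` (and the sharp `2q²` in general position) for any pair whose fibres have at most two weak tops per weight

Memo `Cruxes/DissociatedUniform/NOTES-d1g3.md` §2 L5: "regime `c₃ ≫ fibres` (c₃ convex): the cones partition the circle, so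
`Σ_s #exposed P-edges = Σ_r |E_r| ≤ q²` and `T(3) = q² + #bridges ≤ 2q²`".  The tree had this end of the law only with the crude constant
`17` (`…TotalsLawLargeThird`, any `a, b`, injective `c`) and, since this seat, with constants `3` / `2` for pairs with SHARP-topped (strictly
convex) fibres (`…TotalsLawSharpFibreTotals`).  This file removes the convexity of the fibres: for ANY pair `a, b` whose fibres
`x ↦ a x + b (r − x)` are injective with AT MOST TWO weak tops per non-zero weight (general position), and `c = c₀ ∘ σ` with `c₀` strictly
convex ccw and `σ` any relabelling,

* `card_partners_le_two`: a label of a two-topped curve is exposed together with at most TWO other labels (three exposing weights in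
  the pointed normal cone: the middle one would expose three labels) ⇒ `card_ordExpPairs_le : #ordered exposed pairs ≤ 2q`;
* `card_cones_of_pair_le_two` (an exposed pair lies in ≤ 2 cones of `C`; `≤ 1` under `PairGP`), `sum_card_ordPairHit_le` (`Σ_s Σ_z ≤ 4q²`);
* **`sum_card_commonDir_le_of_twoTops : Σ_s #CommonDir_s ≤ 3q²`**, **`totalVert_smul_le_three_mul_sq_of_twoTops : T(a,b,μ•(c₀∘σ)) ≤ 3q²`**
  (`μ ≥ μ₀`), and under `PairGP` (no weight exposes both a fibre pair and an edge of `C`) **`totalVert_smul_le_two_mul_sq_of_twoTops_gp :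
  T ≤ 2q²`** — the memo's sharp dominant-regime constant for all pairs in general position.
Honest label: a regime theorem (third curve dominant, convex); `SmoothSharpTotalsLaw`, `TotalsLawThree` remain OPEN; nothing here bears on
VP ≠ VNP.
[folklore]
-/

set_option linter.dupNamespace false -- `ValiantsHypothesis.ValiantsHypothesis` (summit = problem) in every name

open scoped BigOperators

namespace Summit.ValiantsHypothesis.ValiantsHypothesis.Theorems.NewtonUnitEquationsDissociatedUniform

namespace TotalsLaw

open Matrix Real

section TwoTopsTotals

variable {q : ℕ} [NeZero q]

/-! #### Exposed pairs of a two-topped curve -/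

omit [NeZero q] in
/-- **Uniqueness of the exposing direction of a pair** (two-topped curve, distinct points, `q ≥ 3`). [folklore] -/
theorem exposing_unique_pair {P : ZMod q → (Fin 2 → ℝ)} (hP : TwoTops P) (hq : 3 ≤ q) {x y : ZMod q} (hxy : P y ≠ P x)
    {θ θ' : Fin 2 → ℝ} (hθ : θ ≠ 0) (hθ' : θ' ≠ 0) (hx : WTop P θ x) (hy : WTop P θ y) (hx' : WTop P θ' x) (hy' : WTop P θ' y) :
    ∃ t : ℝ, 0 < t ∧ θ' = t • θ := by
  set d : Fin 2 → ℝ := P y - P x with hd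
  have hd0 : d ≠ 0 := sub_ne_zero.2 hxy
  have hθd : θ ⬝ᵥ d = 0 := by rw [hd, dotProduct_sub]; linarith [hx y, hy x]
  have hθ'd : θ' ⬝ᵥ d = 0 := by rw [hd, dotProduct_sub]; linarith [hx' y, hy' x]
  have eθ := eq_smul_perp_of_dotProduct_eq_zero hd0 hθd
  have eθ' := eq_smul_perp_of_dotProduct_eq_zero hd0 hθ'd
  have hcθ : cross2 d θ ≠ 0 := by
    intro h0c
    rw [h0c, neg_zero, zero_div, zero_smul] at eθ
    exact hθ eθ
  set t : ℝ := cross2 d θ' / cross2 d θ with ht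
  have hθ't : θ' = t • θ := by
    rw [eθ', eθ, smul_smul]
    congr 1
    rw [ht]; field_simp
  have ht0 : t ≠ 0 := by
    intro h; rw [h, zero_smul] at hθ't; exact hθ' hθ't
  refine ⟨t, ?_, hθ't⟩
  rcases lt_or_gt_of_ne ht0 with hneg | hpos
  · exfalso
    have hall : ∀ w, WTop P θ w := by
      intro w v
      have e1 := hx v
      have e2 := hx' w
      rw [hθ't, smul_dotProduct, smul_dotProduct, smul_eq_mul, smul_eq_mul] at e2
      have e3 : θ ⬝ᵥ P x ≤ θ ⬝ᵥ P w := by nlinarith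
      have e4 := hx w
      linarith
    have h1ne : (1 : ZMod q) ≠ 0 := one_ne_zero_of_three_le hq
    have h2ne : (2 : ZMod q) ≠ 0 := two_ne_zero_of_three_le hq
    rcases hP θ hθ 0 1 2 (hall 0) (hall 1) (hall 2) with h | h | h
    · exact h1ne h.symm
    · exact h1ne (by linear_combination -h)
    · exact h2ne h.symm
  · exact hpos

open scoped Classical in
/-- An exposed pair of a two-topped injective curve lies inside the cones of at most two vertices of a curve `c` with at most two weak tops
per weight. [folklore] -/
theorem card_cones_of_pair_le_two {c : ZMod q → (Fin 2 → ℝ)} (hc : TwoTops c) {P : ZMod q → (Fin 2 → ℝ)} (hP : TwoTops P)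
    (hq : 3 ≤ q) {x y : ZMod q} (hxy : P y ≠ P x) :
    (Finset.univ.filter fun z : ZMod q => ∃ θ : Fin 2 → ℝ, θ ≠ 0 ∧ WTop c θ z ∧ WTop P θ x ∧ WTop P θ y).card ≤ 2 := by
  by_contra hgt
  obtain ⟨u, hu, v, hv, w, hw, huv, huw, hvw⟩ := Finset.two_lt_card.1 (not_le.1 hgt)
  simp only [Finset.mem_filter, Finset.mem_univ, true_and] at hu hv hw
  obtain ⟨θ, hθ, hcu, hu0, hu1⟩ := hu
  obtain ⟨θv, hθv, hcv, hv0, hv1⟩ := hv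
  obtain ⟨θw, hθw, hcw, hw0, hw1⟩ := hw
  obtain ⟨tv, htv, rfl⟩ := exposing_unique_pair hP hq hxy hθ hθv hu0 hu1 hv0 hv1
  obtain ⟨tw, htw, rfl⟩ := exposing_unique_pair hP hq hxy hθ hθw hu0 hu1 hw0 hw1
  rw [wTop_smul_iff c htv] at hcv
  rw [wTop_smul_iff c htw] at hcw
  rcases hc θ hθ u v w hcu hcv hcw with h | h | h
  · exact huv h
  · exact hvw h
  · exact huw h

open scoped Classical in
/-- **At most two partners.**  A label `x` of a two-topped curve (`q ≥ 3`) is exposed together with at most TWO other labels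
(of three exposing weights in the normal cone at `x`, one is a positive combination of the other two or they sum to a line; either way a
third label would be exposed with `x` at one weight). [folklore] -/
theorem card_partners_le_two {P : ZMod q → (Fin 2 → ℝ)} (hP : TwoTops P) (hq : 3 ≤ q) (x : ZMod q) :
    (Finset.univ.filter fun y : ZMod q => y ≠ x ∧ ∃ θ : Fin 2 → ℝ, θ ≠ 0 ∧ WTop P θ x ∧ WTop P θ y).card ≤ 2 := by
  by_contra hgt
  obtain ⟨y₁, h₁, y₂, h₂, y₃, h₃, h12, h13, h23⟩ := Finset.two_lt_card.1 (not_le.1 hgt)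
  simp only [Finset.mem_filter, Finset.mem_univ, true_and] at h₁ h₂ h₃
  obtain ⟨hy₁, θ₁, hθ₁, hx₁, hy₁'⟩ := h₁
  obtain ⟨hy₂, θ₂, hθ₂, hx₂, hy₂'⟩ := h₂
  obtain ⟨hy₃, θ₃, hθ₃, hx₃, hy₃'⟩ := h₃
  -- no third top at any of the three weights
  have only : ∀ {θ : Fin 2 → ℝ} {y y' : ZMod q}, θ ≠ 0 → y ≠ x → y' ≠ x → y ≠ y' → WTop P θ x → WTop P θ y →
      ¬ WTop P θ y' := by
    intro θ y y' hθ hy hy' hyy' hx hyt hy't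
    rcases hP θ hθ x y y' hx hyt hy't with h | h | h
    · exact hy h.symm
    · exact hyy' h
    · exact hy' h.symm
  -- the three weights are pairwise independent
  have indep : ∀ {θ θ' : Fin 2 → ℝ} {y y' : ZMod q}, θ ≠ 0 → θ' ≠ 0 → y ≠ x → y' ≠ x → y ≠ y' → WTop P θ x → WTop P θ y →
      WTop P θ' x → WTop P θ' y' → cross2 θ θ' ≠ 0 := by
    intro θ θ' y y' hθ hθ' hy hy' hyy' hx hyt hx' hy't hc0
    -- `θ'` is a multiple of `θ`
    have hpar : ∃ t : ℝ, θ' = t • θ := by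
      by_cases h0 : θ 0 = 0
      · have h1 : θ 1 ≠ 0 := fun h1 => hθ (by ext i; fin_cases i <;> simp [h0, h1])
        refine ⟨θ' 1 / θ 1, ?_⟩
        have : θ' 0 = 0 := by simp only [cross2, h0, zero_mul, zero_sub, neg_eq_zero, mul_eq_zero] at hc0; tauto
        ext i; fin_cases i
        · simp [h0, this]
        · simp only [Fin.mk_one, Fin.isValue, Pi.smul_apply, smul_eq_mul]; field_simp
      · refine ⟨θ' 0 / θ 0, ?_⟩
        ext i; fin_cases i
        · simp only [Fin.zero_eta, Fin.isValue, Pi.smul_apply, smul_eq_mul]; field_simp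
        · simp only [Fin.mk_one, Fin.isValue, Pi.smul_apply, smul_eq_mul]
          simp only [cross2] at hc0
          field_simp; linarith
    obtain ⟨t, rfl⟩ := hpar
    rcases lt_trichotomy t 0 with ht | ht | ht
    · -- negative multiple: `x` is top and bottom for `θ`, every label is a top
      have hall : ∀ w, WTop P θ w := by
        intro w v
        have e1 := hx v
        have e2 := hx' w
        rw [smul_dotProduct, smul_dotProduct, smul_eq_mul, smul_eq_mul] at e2
        have e3 : θ ⬝ᵥ P x ≤ θ ⬝ᵥ P w := by nlinarith
        linarith [hx w]
      exact only hθ hy hy' hyy' hx hyt (hall y')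
    · rw [ht, zero_smul] at hθ'; exact hθ' rfl
    · rw [wTop_smul_iff P ht] at hy't
      exact only hθ hy hy' hyy' hx hyt hy't
  have c12 := indep hθ₁ hθ₂ hy₁ hy₂ h12 hx₁ hy₁' hx₂ hy₂'
  have c13 := indep hθ₁ hθ₃ hy₁ hy₃ h13 hx₁ hy₁' hx₃ hy₃'
  have c23 := indep hθ₂ hθ₃ hy₂ hy₃ h23 hx₂ hy₂' hx₃ hy₃'
  -- Cramer: `Δ ⟨θ₃, d⟩ = A ⟨θ₁, d⟩ + B ⟨θ₂, d⟩` for every `d`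
  have cram : ∀ d : Fin 2 → ℝ, cross2 θ₁ θ₂ * (θ₃ ⬝ᵥ d) = cross2 θ₃ θ₂ * (θ₁ ⬝ᵥ d) + cross2 θ₁ θ₃ * (θ₂ ⬝ᵥ d) := by
    intro d
    have := cross2_mul_dotProduct d θ₁ θ₂ θ₃
    rw [dotProduct_comm d θ₃, dotProduct_comm d θ₁, dotProduct_comm d θ₂] at this
    exact this
  have hA : cross2 θ₃ θ₂ ≠ 0 := by rw [cross2_swap]; exact neg_ne_zero.2 c23
  have hB : cross2 θ₁ θ₃ ≠ 0 := c13
  -- the sign conditions `⟨θ_i, P w − P x⟩ ≤ 0`, with equality making `w` a top at `θ_i`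
  have le1 : ∀ w, θ₁ ⬝ᵥ (P w - P x) ≤ 0 := fun w => by rw [dotProduct_sub]; linarith [hx₁ w]
  have le2 : ∀ w, θ₂ ⬝ᵥ (P w - P x) ≤ 0 := fun w => by rw [dotProduct_sub]; linarith [hx₂ w]
  have le3 : ∀ w, θ₃ ⬝ᵥ (P w - P x) ≤ 0 := fun w => by rw [dotProduct_sub]; linarith [hx₃ w]
  have top_of_eq : ∀ {θ : Fin 2 → ℝ} {w : ZMod q}, WTop P θ x → θ ⬝ᵥ (P w - P x) = 0 → WTop P θ w := by
    intro θ w hxt h v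
    rw [dotProduct_sub] at h
    linarith [hxt v]
  have eq1 : θ₁ ⬝ᵥ (P y₁ - P x) = 0 := by rw [dotProduct_sub]; linarith [hx₁ y₁, hy₁' x]
  have eq2 : θ₂ ⬝ᵥ (P y₂ - P x) = 0 := by rw [dotProduct_sub]; linarith [hx₂ y₂, hy₂' x]
  have eq3 : θ₃ ⬝ᵥ (P y₃ - P x) = 0 := by rw [dotProduct_sub]; linarith [hx₃ y₃, hy₃' x]
  set Δ := cross2 θ₁ θ₂ with hΔ
  set A := cross2 θ₃ θ₂ with hAdef
  set B := cross2 θ₁ θ₃ with hBdef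
  -- sign analysis of `a = A/Δ`, `b = B/Δ`
  have hΔ2 : 0 < Δ * Δ := mul_self_pos.2 c12
  have nonneg_of : ∀ {u : ℝ}, 0 ≤ Δ * Δ * u → 0 ≤ u := fun {u} h => by
    by_contra hneg
    have : Δ * Δ * u < 0 := mul_neg_of_pos_of_neg hΔ2 (not_le.1 hneg)
    linarith
  have cramΔ : ∀ d : Fin 2 → ℝ, Δ * Δ * (θ₃ ⬝ᵥ d) = (A * Δ) * (θ₁ ⬝ᵥ d) + (B * Δ) * (θ₂ ⬝ᵥ d) := fun d => by
    linear_combination Δ * cram d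
  rcases lt_or_gt_of_ne (mul_ne_zero hA c12 : A * Δ ≠ 0) with hAΔ | hAΔ <;>
    rcases lt_or_gt_of_ne (mul_ne_zero hB c12 : B * Δ ≠ 0) with hBΔ | hBΔ
  · -- a < 0, b < 0 : `⟨θ₃, d_w⟩ ≥ 0` for all `w`, so every label is a top at `θ₃`
    have hall : ∀ w, WTop P θ₃ w := by
      intro w
      apply top_of_eq hx₃
      have p1 : 0 ≤ (A * Δ) * (θ₁ ⬝ᵥ (P w - P x)) := mul_nonneg_of_nonpos_of_nonpos hAΔ.le (le1 w)
      have p2 : 0 ≤ (B * Δ) * (θ₂ ⬝ᵥ (P w - P x)) := mul_nonneg_of_nonpos_of_nonpos hBΔ.le (le2 w)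
      have h3 : 0 ≤ θ₃ ⬝ᵥ (P w - P x) := nonneg_of (by rw [cramΔ]; linarith)
      linarith [le3 w]
    have h1ne : (1 : ZMod q) ≠ 0 := one_ne_zero_of_three_le hq
    have h2ne : (2 : ZMod q) ≠ 0 := two_ne_zero_of_three_le hq
    rcases hP θ₃ hθ₃ 0 1 2 (hall 0) (hall 1) (hall 2) with h | h | h
    · exact h1ne h.symm
    · exact h1ne (by linear_combination -h)
    · exact h2ne h.symm
  · -- a < 0, b > 0 : `y₂` is a top at `θ₃`
    have p1 : 0 ≤ (A * Δ) * (θ₁ ⬝ᵥ (P y₂ - P x)) := mul_nonneg_of_nonpos_of_nonpos hAΔ.le (le1 y₂)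
    have h3 : 0 ≤ θ₃ ⬝ᵥ (P y₂ - P x) := nonneg_of (by rw [cramΔ, eq2, mul_zero, add_zero]; exact p1)
    have h3' : θ₃ ⬝ᵥ (P y₂ - P x) = 0 := le_antisymm (le3 y₂) h3
    exact only hθ₃ hy₃ hy₂ (Ne.symm h23) hx₃ hy₃' (top_of_eq hx₃ h3')
  · -- a > 0, b < 0 : `y₁` is a top at `θ₃`
    have p2 : 0 ≤ (B * Δ) * (θ₂ ⬝ᵥ (P y₁ - P x)) := mul_nonneg_of_nonpos_of_nonpos hBΔ.le (le2 y₁)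
    have h3 : 0 ≤ θ₃ ⬝ᵥ (P y₁ - P x) := nonneg_of (by rw [cramΔ, eq1, mul_zero, zero_add]; exact p2)
    have h3' : θ₃ ⬝ᵥ (P y₁ - P x) = 0 := le_antisymm (le3 y₁) h3
    exact only hθ₃ hy₃ hy₁ (Ne.symm h13) hx₃ hy₃' (top_of_eq hx₃ h3')
  · -- a > 0, b > 0 : `θ₃` is between, `y₃` is a top at `θ₁`
    have e := cramΔ (P y₃ - P x)
    rw [eq3, mul_zero] at e
    have p1 : (A * Δ) * (θ₁ ⬝ᵥ (P y₃ - P x)) ≤ 0 := mul_nonpos_of_nonneg_of_nonpos hAΔ.le (le1 y₃)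
    have p2 : (B * Δ) * (θ₂ ⬝ᵥ (P y₃ - P x)) ≤ 0 := mul_nonpos_of_nonneg_of_nonpos hBΔ.le (le2 y₃)
    have p1' : (A * Δ) * (θ₁ ⬝ᵥ (P y₃ - P x)) = 0 := by linarith
    have h1 : θ₁ ⬝ᵥ (P y₃ - P x) = 0 := by
      rcases mul_eq_zero.1 p1' with h | h
      · exact absurd h (mul_ne_zero hA c12)
      · exact h
    exact only hθ₁ hy₁ hy₃ h13 hx₁ hy₁' (top_of_eq hx₁ h1)

/-- Counting over a product label by label (general finite types). [folklore] -/
theorem card_filter_prod_eq_sum' {α β : Type*} [Fintype α] [Fintype β] (p : α × β → Prop) [DecidablePred p] :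
    (Finset.univ.filter p).card = ∑ a : α, (Finset.univ.filter fun b : β => p (a, b)).card := by
  classical
  simp only [Finset.card_filter]
  rw [Fintype.sum_prod_type]

open scoped Classical in
/-- **At most `2q` ordered exposed pairs** for a two-topped curve (`q ≥ 3`). [folklore] -/
theorem card_ordExpPairs_le {P : ZMod q → (Fin 2 → ℝ)} (hP : TwoTops P) (hq : 3 ≤ q) :
    (Finset.univ.filter fun xy : ZMod q × ZMod q =>
      xy.1 ≠ xy.2 ∧ ∃ θ : Fin 2 → ℝ, θ ≠ 0 ∧ WTop P θ xy.1 ∧ WTop P θ xy.2).card ≤ 2 * q := by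
  rw [card_filter_prod_eq_sum']
  calc ∑ x : ZMod q, (Finset.univ.filter fun y : ZMod q => x ≠ y ∧ ∃ θ : Fin 2 → ℝ, θ ≠ 0 ∧ WTop P θ x ∧ WTop P θ y).card
      ≤ ∑ _x : ZMod q, 2 := Finset.sum_le_sum fun x _ => by
        refine le_trans (le_of_eq (congrArg Finset.card (Finset.filter_congr fun y _ => ?_))) (card_partners_le_two hP hq x)
        exact ⟨fun h => ⟨Ne.symm h.1, h.2⟩, fun h => ⟨Ne.symm h.1, h.2⟩⟩
    _ = 2 * q := by rw [Finset.sum_const, Finset.card_univ, ZMod.card, smul_eq_mul, mul_comm]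

/-! #### The incidence count and the totals -/

/-- GENERAL POSITION of pairs against the third polygon: a weight exposing two distinct labels of a fibre has a unique weak top on `C`. -/
def PairGP (a b c : ZMod q → (Fin 2 → ℝ)) : Prop :=
  ∀ (r x y : ZMod q) (θ : Fin 2 → ℝ), θ ≠ 0 → x ≠ y → WTop (fibreCurve a b r) θ x → WTop (fibreCurve a b r) θ y →
    ∀ z z' : ZMod q, WTop c θ z → WTop c θ z' → z = z'

open scoped Classical in
/-- **The ordered-pair incidences `(s, z, x, y)` number at most `4q²`** (`2q²` under `PairGP`). [folklore] -/
theorem sum_card_ordPairHit_le (a b c : ZMod q → (Fin 2 → ℝ)) (hq : 3 ≤ q) (hc : TwoTops c)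
    (hT : ∀ r, TwoTops (fibreCurve a b r)) (hI : ∀ r, Function.Injective (fibreCurve a b r)) (K : ℕ)
    (hK : K = 2 ∨ (K = 1 ∧ PairGP a b c)) :
    ∑ s : ZMod q, (Finset.univ.filter fun zxy : ZMod q × (ZMod q × ZMod q) => zxy.2.1 ≠ zxy.2.2 ∧ ∃ θ : Fin 2 → ℝ, θ ≠ 0 ∧
      WTop c θ zxy.1 ∧ WTop (fibreCurve a b (s - zxy.1)) θ zxy.2.1 ∧ WTop (fibreCurve a b (s - zxy.1)) θ zxy.2.2).card
      ≤ 2 * K * q ^ 2 := by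
  set Q : ZMod q → ZMod q × (ZMod q × ZMod q) → Prop := fun s rxy => rxy.2.1 ≠ rxy.2.2 ∧ ∃ θ : Fin 2 → ℝ, θ ≠ 0 ∧
    WTop c θ (s - rxy.1) ∧ WTop (fibreCurve a b rxy.1) θ rxy.2.1 ∧ WTop (fibreCurve a b rxy.1) θ rxy.2.2 with hQ
  have hre : ∀ s : ZMod q, (Finset.univ.filter fun zxy : ZMod q × (ZMod q × ZMod q) => zxy.2.1 ≠ zxy.2.2 ∧ ∃ θ : Fin 2 → ℝ,
      θ ≠ 0 ∧ WTop c θ zxy.1 ∧ WTop (fibreCurve a b (s - zxy.1)) θ zxy.2.1 ∧ WTop (fibreCurve a b (s - zxy.1)) θ zxy.2.2).card =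
      (Finset.univ.filter fun rxy : ZMod q × (ZMod q × ZMod q) => Q s rxy).card := by
    intro s
    refine Finset.card_equiv ((Equiv.subLeft s).prodCongr (Equiv.refl _)) fun zxy => ?_
    simp only [Finset.mem_filter, Finset.mem_univ, true_and, Equiv.prodCongr_apply, Equiv.coe_refl, Prod.map_fst, Prod.map_snd,
      Equiv.subLeft_apply, id_eq, sub_sub_cancel, hQ]
  simp_rw [hre]
  have hfub : ∑ s : ZMod q, (Finset.univ.filter fun rxy : ZMod q × (ZMod q × ZMod q) => Q s rxy).card =
      ∑ rxy : ZMod q × (ZMod q × ZMod q), (Finset.univ.filter fun s : ZMod q => Q s rxy).card := by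
    simp only [Finset.card_filter]
    rw [Finset.sum_comm]
  rw [hfub]
  -- per exposed pair: at most `K` cones; per non-exposed pair: nothing
  set EP : ZMod q × (ZMod q × ZMod q) → Prop := fun rxy => rxy.2.1 ≠ rxy.2.2 ∧ ∃ θ : Fin 2 → ℝ, θ ≠ 0 ∧
    WTop (fibreCurve a b rxy.1) θ rxy.2.1 ∧ WTop (fibreCurve a b rxy.1) θ rxy.2.2 with hEP
  have hper : ∀ rxy : ZMod q × (ZMod q × ZMod q),
      (Finset.univ.filter fun s : ZMod q => Q s rxy).card ≤ K * (if EP rxy then 1 else 0) := by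
    intro rxy
    by_cases hE : EP rxy
    · rw [if_pos hE, mul_one]
      have hxy : fibreCurve a b rxy.1 rxy.2.2 ≠ fibreCurve a b rxy.1 rxy.2.1 := fun h => hE.1 ((hI rxy.1) h).symm
      -- re-index `s ↦ s − r`
      have hz : (Finset.univ.filter fun s : ZMod q => Q s rxy).card = (Finset.univ.filter fun z : ZMod q => ∃ θ : Fin 2 → ℝ, θ ≠ 0 ∧
          WTop c θ z ∧ WTop (fibreCurve a b rxy.1) θ rxy.2.1 ∧ WTop (fibreCurve a b rxy.1) θ rxy.2.2).card := by
        refine Finset.card_equiv (Equiv.subRight rxy.1) fun s => ?_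
        simp only [Finset.mem_filter, Finset.mem_univ, true_and, Equiv.subRight_apply, hQ]
        exact ⟨fun h => h.2, fun h => ⟨hE.1, h⟩⟩
      rw [hz]
      rcases hK with rfl | ⟨rfl, hgp⟩
      · exact card_cones_of_pair_le_two hc (hT rxy.1) hq hxy
      · refine Finset.card_le_one.2 fun z hz1 z' hz2 => ?_
        simp only [Finset.mem_filter, Finset.mem_univ, true_and] at hz1 hz2
        obtain ⟨θ, hθ, hcz, h1, h2⟩ := hz1
        obtain ⟨θ', hθ', hcz', h1', h2'⟩ := hz2
        obtain ⟨t, ht, rfl⟩ := exposing_unique_pair (hT rxy.1) hq hxy hθ hθ' h1 h2 h1' h2'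
        rw [wTop_smul_iff c ht] at hcz'
        exact hgp rxy.1 rxy.2.1 rxy.2.2 θ hθ hE.1 h1 h2 z z' hcz hcz'
    · rw [if_neg hE, mul_zero]
      refine le_of_eq (Finset.card_eq_zero.2 (Finset.filter_eq_empty_iff.2 fun s _ hs => hE ?_))
      exact ⟨hs.1, hs.2.imp fun θ h => ⟨h.1, h.2.2⟩⟩
  have hEPcard : (Finset.univ.filter EP).card ≤ 2 * q * q := by
    rw [card_filter_prod_eq_sum']
    calc ∑ r : ZMod q, (Finset.univ.filter fun xy : ZMod q × ZMod q => EP (r, xy)).card ≤ ∑ _r : ZMod q, 2 * q :=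
          Finset.sum_le_sum fun r _ => card_ordExpPairs_le (hT r) hq
      _ = 2 * q * q := by rw [Finset.sum_const, Finset.card_univ, ZMod.card, smul_eq_mul]; ring
  calc ∑ rxy : ZMod q × (ZMod q × ZMod q), (Finset.univ.filter fun s : ZMod q => Q s rxy).card
      ≤ ∑ rxy : ZMod q × (ZMod q × ZMod q), K * (if EP rxy then 1 else 0) := Finset.sum_le_sum fun rxy _ => hper rxy
    _ = K * (Finset.univ.filter EP).card := by rw [← Finset.mul_sum, Finset.sum_boole]; simp
    _ ≤ K * (2 * q * q) := Nat.mul_le_mul_left K hEPcard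
    _ = 2 * K * q ^ 2 := by ring

open scoped Classical in
/-- The relabelled cone sweep count for two-topped fibres. [folklore] -/
theorem two_mul_card_commonTop_le_comp {c : ZMod q → (Fin 2 → ℝ)} (hc : StrictlyConvexCcw c) (hq : 3 ≤ q) (σ : ZMod q ≃ ZMod q)
    {P : ZMod q → (Fin 2 → ℝ)} (hP : TwoTops P) (z : ZMod q) :
    2 * (Finset.univ.filter fun x : ZMod q => ∃ θ : Fin 2 → ℝ, θ ≠ 0 ∧ WTop (c ∘ σ) θ z ∧ WTop P θ x).card ≤
      2 + (Finset.univ.filter fun xy : ZMod q × ZMod q =>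
        xy.1 ≠ xy.2 ∧ ∃ θ : Fin 2 → ℝ, θ ≠ 0 ∧ WTop (c ∘ σ) θ z ∧ WTop P θ xy.1 ∧ WTop P θ xy.2).card := by
  simp only [wTop_comp_equiv]
  exact two_mul_card_commonTop_le hc hq hP (σ z)

open scoped Classical in
/-- **`Σ_s #{CommonDir_s} ≤ (1 + K) q²`** for a pair with two-topped injective fibres and a relabelled strictly convex ccw third polygon
(`K = 2` always, `K = 1` under `PairGP`). [folklore] -/
theorem sum_card_commonDir_le_of_twoTops (a b : ZMod q → (Fin 2 → ℝ)) {c₀ : ZMod q → (Fin 2 → ℝ)} (hc₀ : StrictlyConvexCcw c₀)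
    (hq : 3 ≤ q) (σ : ZMod q ≃ ZMod q) (hT : ∀ r, TwoTops (fibreCurve a b r)) (hI : ∀ r, Function.Injective (fibreCurve a b r))
    (K : ℕ) (hK : K = 2 ∨ (K = 1 ∧ PairGP a b (c₀ ∘ σ))) :
    ∑ s : ZMod q, (Finset.univ.filter fun zx : ZMod q × ZMod q => CommonDir a b (c₀ ∘ σ) s zx.1 zx.2).card ≤ (1 + K) * q ^ 2 := by
  have hc3 : TwoTops (c₀ ∘ σ) := by
    intro θ hθ x y w hx hy hw
    rw [wTop_comp_equiv] at hx hy hw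
    rcases (sharpTops_of_strictlyConvexCcw hc₀ hq θ hθ).2 _ _ _ hx hy hw with e | e | e
    · left; exact σ.injective e
    · right; left; exact σ.injective e
    · right; right; exact σ.injective e
  -- per class: `2·#CommonDir_s ≤ 2q + #ordered pair incidences of class s`
  have hcls : ∀ s : ZMod q, 2 * (Finset.univ.filter fun zx : ZMod q × ZMod q => CommonDir a b (c₀ ∘ σ) s zx.1 zx.2).card ≤
      2 * q + (Finset.univ.filter fun zxy : ZMod q × (ZMod q × ZMod q) => zxy.2.1 ≠ zxy.2.2 ∧ ∃ θ : Fin 2 → ℝ, θ ≠ 0 ∧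
        WTop (c₀ ∘ σ) θ zxy.1 ∧ WTop (fibreCurve a b (s - zxy.1)) θ zxy.2.1 ∧ WTop (fibreCurve a b (s - zxy.1)) θ zxy.2.2).card := by
    intro s
    rw [card_filter_prod_eq_sum, card_filter_prod_eq_sum', Finset.mul_sum]
    calc ∑ z : ZMod q, 2 * (Finset.univ.filter fun x => CommonDir a b (c₀ ∘ σ) s z x).card
        ≤ ∑ z : ZMod q, (2 + (Finset.univ.filter fun xy : ZMod q × ZMod q => xy.1 ≠ xy.2 ∧ ∃ θ : Fin 2 → ℝ, θ ≠ 0 ∧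
            WTop (c₀ ∘ σ) θ z ∧ WTop (fibreCurve a b (s - z)) θ xy.1 ∧ WTop (fibreCurve a b (s - z)) θ xy.2).card) :=
          Finset.sum_le_sum fun z _ => two_mul_card_commonTop_le_comp hc₀ hq σ (hT (s - z)) z
      _ = 2 * q + _ := by rw [Finset.sum_add_distrib, Finset.sum_const, Finset.card_univ, ZMod.card, smul_eq_mul, mul_comm]
  have hsum := sum_card_ordPairHit_le a b (c₀ ∘ σ) hq hc3 hT hI K hK
  have h2 : 2 * ∑ s : ZMod q, (Finset.univ.filter fun zx : ZMod q × ZMod q => CommonDir a b (c₀ ∘ σ) s zx.1 zx.2).card ≤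
      2 * q * q + 2 * K * q ^ 2 := by
    rw [Finset.mul_sum]
    refine le_trans (Finset.sum_le_sum fun s _ => hcls s) ?_
    rw [Finset.sum_add_distrib, Finset.sum_const, Finset.card_univ, ZMod.card, smul_eq_mul]
    linarith
  nlinarith

/-- **THE DOMINANT-REGIME TOTALS LAW FOR GENERAL PAIRS: `T ≤ 3q²`.**  For ANY pair `a, b` whose fibres are injective with at most two weak
tops per weight, and `c = c₀ ∘ σ` a relabelled strictly convex ccw polygon (`q ≥ 3`): `T(a, b, μ•c) ≤ 3q²` for `μ ≥ μ₀`. [folklore] -/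
theorem totalVert_smul_le_three_mul_sq_of_twoTops (a b : ZMod q → (Fin 2 → ℝ)) {c₀ : ZMod q → (Fin 2 → ℝ)}
    (hc₀ : StrictlyConvexCcw c₀) (hq : 3 ≤ q) (σ : ZMod q ≃ ZMod q) (hT : ∀ r, TwoTops (fibreCurve a b r))
    (hI : ∀ r, Function.Injective (fibreCurve a b r)) :
    ∃ μ₀ : ℝ, ∀ μ : ℝ, μ₀ ≤ μ → totalVert a b (μ • (c₀ ∘ σ)) ≤ 3 * q ^ 2 := by
  classical
  choose f hf using fun s => classVert_smul_le_card_commonDir a b (c₀ ∘ σ) s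
  refine ⟨Finset.univ.sup' Finset.univ_nonempty f, fun μ hμ => ?_⟩
  unfold totalVert
  calc ∑ s, classVert a b (μ • (c₀ ∘ σ)) s
      ≤ ∑ s : ZMod q, (Finset.univ.filter fun zx : ZMod q × ZMod q => CommonDir a b (c₀ ∘ σ) s zx.1 zx.2).card :=
        Finset.sum_le_sum fun s _ => hf s μ ((Finset.le_sup' f (Finset.mem_univ s)).trans hμ)
    _ ≤ (1 + 2) * q ^ 2 := sum_card_commonDir_le_of_twoTops a b hc₀ hq σ hT hI 2 (Or.inl rfl)
    _ = 3 * q ^ 2 := by ring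

/-- **THE SHARP CONSTANT IN GENERAL POSITION: `T ≤ 2q²`** (memo NOTES-d1g3 §2 L5 "`T = q² + #bridges ≤ 2q²`") for two-topped injective
fibres, a relabelled strictly convex ccw third polygon, and no weight exposing both a fibre pair and an edge of `C`. [folklore] -/
theorem totalVert_smul_le_two_mul_sq_of_twoTops_gp (a b : ZMod q → (Fin 2 → ℝ)) {c₀ : ZMod q → (Fin 2 → ℝ)}
    (hc₀ : StrictlyConvexCcw c₀) (hq : 3 ≤ q) (σ : ZMod q ≃ ZMod q) (hT : ∀ r, TwoTops (fibreCurve a b r))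
    (hI : ∀ r, Function.Injective (fibreCurve a b r)) (hgp : PairGP a b (c₀ ∘ σ)) :
    ∃ μ₀ : ℝ, ∀ μ : ℝ, μ₀ ≤ μ → totalVert a b (μ • (c₀ ∘ σ)) ≤ 2 * q ^ 2 := by
  classical
  choose f hf using fun s => classVert_smul_le_card_commonDir a b (c₀ ∘ σ) s
  refine ⟨Finset.univ.sup' Finset.univ_nonempty f, fun μ hμ => ?_⟩
  unfold totalVert
  calc ∑ s, classVert a b (μ • (c₀ ∘ σ)) s
      ≤ ∑ s : ZMod q, (Finset.univ.filter fun zx : ZMod q × ZMod q => CommonDir a b (c₀ ∘ σ) s zx.1 zx.2).card :=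
        Finset.sum_le_sum fun s _ => hf s μ ((Finset.le_sup' f (Finset.mem_univ s)).trans hμ)
    _ ≤ (1 + 1) * q ^ 2 := sum_card_commonDir_le_of_twoTops a b hc₀ hq σ hT hI 1 (Or.inr ⟨rfl, hgp⟩)
    _ = 2 * q ^ 2 := by ring

end TwoTopsTotals

end TotalsLaw

end Summit.ValiantsHypothesis.ValiantsHypothesis.Theorems.NewtonUnitEquationsDissociatedUniform
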